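import Literature.Geometry.ComplexHyperbolic.UnitBallU21Borel                 -- ★ `U21`, its Borel ∕ locally compact ∕ second countable instances
import Literature.NumberTheory.Automorphic.UnitaryFormGroupUnimodular         -- ★ `modularCharacterFun_unitaryGroupOfForm_eq_one` (`U(⋆, H)(ℂ)` unimodular)
import Literature.NumberTheory.Automorphic.GLnAdelicIntegrationFactsProofs    -- ★ `isMulRightInvariant_of_modularCharacterFun_eq_one`
import HarnessLib

/-!
# `U(2,1)` (ball model `U21`) is unimodular: every Haar measure on `U21` is right invariant

Topic `Geometry/ComplexHyperbolic`; namespace `Literature.Geometry.ComplexHyperbolic.BallModel`.  THEOREMS ONLY (no `def`, no instance, no notation, no axiom, no named fact,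
no `sorry`).  Cell `pub/hodgecm-mathlib`, ENGINE T1 (crux H413 = `stmt-HodgeConjecture-24833`); floor-1½ preparation, count-neutral, under row (S-d) ∕ «SdArch» ED. 3 node N1 =
the (L_{U(2,1)}) letter.  Discharges the standing hypothesis `[μ.IsMulRightInvariant]` next to `[μ.IsHaarMeasure]` in ★ `UnitBallKCentralTransversalTrace`
(`iteratedDeriv_two_integral_kCentral_wallLine_eq_integral_transversalBracket`), ★ `ArchLocalDiagonalFrameU21` §4 and the `χ`-germ.  Author A-p14 (g29), 2026-09-01.

THE MATHEMATICS.  `U21 = {g ∈ GL₃(ℂ) : gᴴJg = J}` IS, as a subgroup of `GL₃(ℂ)`, the tree's `unitaryGroupOfForm (starRingEnd ℂ) J` (**`U21_eq_unitaryGroupOfForm`**, definitional up to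
`gᴴ = (g.map ⋆)ᵀ`); `J = diag(1,1,−1)` is hermitian with `det J = −1 ≠ 0`, so ★ `modularCharacterFun_unitaryGroupOfForm_eq_one` (reductive real groups are unimodular —
here via the Sylvester frame and the Cartan-involution argument of ★ `UnitaryFormGroupUnimodular`) gives `Δ ≡ 1` on it; transported along the identity isomorphism of the two equal
subgroups (**`modularCharacterFun_U21_eq_one`**), and ★ `isMulRightInvariant_of_modularCharacterFun_eq_one` turns it into **`isMulRightInvariant_of_isHaarMeasure_U21`**:
every Haar measure on `U21` is right invariant.
HONEST LABEL: HC_CM is proved only modulo the printed citations until rung 0 closes; this file is a transport of ★ results and pays nothing by itself.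

## References
* [Knapp2002] A. W. Knapp, *Lie Groups Beyond an Introduction*, 2nd ed. (2002), VIII §2 Cor. 8.31 (reductive groups are unimodular).
* [Folland1995] G. B. Folland, *A Course in Abstract Harmonic Analysis* (1995), §2.4 Prop. 2.27–2.28 (the modular function).
-/

set_option autoImplicit false

noncomputable section

open MeasureTheory MeasureTheory.Measure Matrix
open Literature.NumberTheory.Automorphic

namespace Literature.Geometry.ComplexHyperbolic.BallModel

/-- `J = diag(1, 1, −1)` is hermitian. [cite: Knapp2002, VIII §2] -/
theorem isHermitian_J : J.IsHermitian := by
  unfold Matrix.IsHermitian J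
  rw [Matrix.diagonal_conjTranspose]
  congr 1
  funext i
  fin_cases i <;> simp

/-- `det J ≠ 0`. [cite: Knapp2002, VIII §2] -/
theorem det_J_ne_zero : J.det ≠ 0 := by
  rw [det_J]; norm_num

/-- **`U21` is the unitary group of the form `J` for `σ = ⋆`**: `U21 = unitaryGroupOfForm (starRingEnd ℂ) J` as subgroups of `GL₃(ℂ)`. [cite: Knapp2002, VIII §2] -/
theorem U21_eq_unitaryGroupOfForm : U21 = unitaryGroupOfForm (starRingEnd ℂ) J := by
  ext g
  rw [mem_unitaryGroupOfForm_star_iff_conjTranspose]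
  rfl

/-- **`U(2,1)` is unimodular**: `Δ(g) = 1` for every `g ∈ U21`. [cite: Knapp2002, VIII §2 Cor. 8.31] -/
theorem modularCharacterFun_U21_eq_one (g : U21) : modularCharacterFun g = 1 := by
  haveI : LocallyCompactSpace (unitaryGroupOfForm (starRingEnd ℂ) J) := locallyCompactSpace_unitaryGroupOfForm_complex J
  have hset : ((U21 : Subgroup GL3) : Set GL3) = (unitaryGroupOfForm (starRingEnd ℂ) J : Set GL3) :=
    congrArg (fun K : Subgroup GL3 => (K : Set GL3)) U21_eq_unitaryGroupOfForm
  let e : U21 ≃ₜ* unitaryGroupOfForm (starRingEnd ℂ) J :=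
    { MulEquiv.subgroupCongr U21_eq_unitaryGroupOfForm with
      continuous_toFun := (Homeomorph.setCongr hset).continuous
      continuous_invFun := (Homeomorph.setCongr hset).symm.continuous }
  exact modularCharacterFun_eq_one_of_continuousMulEquiv e
    (fun k => modularCharacterFun_unitaryGroupOfForm_eq_one isHermitian_J det_J_ne_zero k) g

/-- **Every Haar measure on `U(2,1)` is right invariant.** [cite: Folland1995, §2.4 Prop. 2.28] [cite: Knapp2002, VIII §2 Cor. 8.31] -/
theorem isMulRightInvariant_of_isHaarMeasure_U21 (μ : Measure U21) [μ.IsHaarMeasure] : μ.IsMulRightInvariant :=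
  isMulRightInvariant_of_modularCharacterFun_eq_one modularCharacterFun_U21_eq_one μ

end Literature.Geometry.ComplexHyperbolic.BallModel

end
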